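import Summits.NavierStokesRegularity.NavierStokesRegularity.Theorems.ScenarioCensusScrewBlowdownVanishing
import HarnessLib

/-!
# LINE «screw-blowdown» port, part 13/13: census KEYS — `ScenarioCensus.Row_A13isqT` / `Row_ArecT` + `row_A13isqT_excluded` / `row_ArecT_excluded`

Re-homed for the scenario census (typer seat ns-census-typer-1 g7; lead g9 RULINGS [7] 20:33Z / [8] 21:03Z / [12](b) 21:58Z: «screw-blowdown v1.8 =
version of record; `Row_A13isqT` DECIDED IN KERNEL → CANDIDATE-DECIDED member under A13 (row already TREE); typer-1 slot 3 port of record =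
`ScrewBlowdown_port_v1_8.lean` bb5f719a8be448dd (stub-free)»; lead g10 RULINGS [1](b) 22:36Z / [2] 22:42Z: «port v1.9 ffe1ad3d1d25e376 = port of record (idea-crit-3 DIFF-CHECK 22:40:40Z CONFORMS); slot 4 = its S3
appendix ADMISSIBLE after slot 3»; ref PRE-CHECKs items 13 / 15 / 20 / 27): VERBATIM PORT of ns-idea-4 LINE g12-1 «screw-blowdown» PORT copy
`pub/ideators/ns-idea-4/lines/screw-blowdown/port/ScrewBlowdown_port_v1_9.lean` sha16 ffe1ad3d1d25e376 (2890 l.; lean check rc 0, 0 sorry; = the v1.8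
port copy bb5f719a8be448dd as a literal prefix — itself the v1.7 copy 674e939b7b0b34e8 + the `LocalPersistence` attack appendix `…LP` + the consequences
`localPersistence_holds` / `farPastSpreading_holds` / `linearConeLiouville_holds` / `row_A13isqT_proved` — plus the v1.9 S3 block: `vanishingBlowdownLiouville_holds`,
`row_ArecT_proved`; parts 1–3 landed while v1.8 was the copy of record, text identical),
split for the 400-line rule into `ScenarioCensusScrewBlowdown` (§1–§3: objects, the cell `Row_A13isqT`, obligation Props, S1 PROVED) →
`…Plumbing` (§4, S2 PROVED) → `…Bridges` (§5 + v1.3) → `…Recurrent` (v1.4, `Row_ArecT`) → `…OffAxis` (v1.5 a) → `…Cone` (v1.5 b: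
`farPast_linearCone_smallness_of_screw`) → `…Residual` (v1.5 c + v1.6: `LinearConeLiouville`, DSS rungs) → `…Propagation` (v1.7: FS, LP,
reductions; the three class-general tools are NOT re-declared — taken BY NAME, general `E`, from `Theorems/TypeIAncientMildForwardUniqueness.lean`,
ns-idea-4 extract a1b589f6dec7da83, p671177) → `…LPTools` / `…LPDuhamel` / `…LP` (the appendix: Gaussian locality, the three-term Oseen split,
time weights; `duhamel_bound`; the bootstrap `one_step` / `persist` / `localPersistence` + the consequences incl. `row_A13isqT_proved`) →
`…Vanishing` (v1.9: S3 proved, `row_ArecT_proved`) → `…Keys` (census keys `Row_A13isqT` / `Row_ArecT` + `_excluded`).  Lean text VERBATIM in namespaces `…Theorems.ScenarioCensus.ScrewBlowdown` / `…ScrewBlowdownLP` (the line's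
`…Lines.ScrewBlowdownPort` / `…PortLP` re-homed; qualified references renamed accordingly); port edits: `local notation "E3"` → `abbrev E3` (the
appendix `open`s it), `@[conjecture]` on `VanishingBlowdownLiouville` only (part 1 landed while S3 was open; an obligation node, now with the closed
witness `vanishingBlowdownLiouville_holds`), seven one-line docstrings added, `continuous_rotZ_angle'` not re-declared (it restates the tree's
`Literature.Analysis.FluidPDE.continuous_rotZ_angle`, gate lint `dedup.landed`; its uses renamed), the line's `set_option linter.unusedVariables false` dropped (five proof lambdas
bind the unused `θ₀ h` as `_ _`; the unused hypothesis binders of `hasVanishingBlowdown_of_axiallyRecurrent` / `pointwise_small_of_zoom_small` are spelled `_hu` / `_hΛ`,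
statements otherwise identical); `set_option maxHeartbeats … in` of the appendix kept as in the line.

No census VALUE is moved by this file (row A13 is TREE already; the lead books the member A13isq-T); NS regularity is NOT proved; (L′)
`SymmetryModuliCount.TypeIAncientLiouville` is untouched (hypothesis of bridges only); no summit statement is proved by this file.
-/

-- the summit and its single problem share the name `NavierStokesRegularity` (D-0017 nested layout)
set_option linter.dupNamespace false

namespace Summit.NavierStokesRegularity.NavierStokesRegularity.Theorems.ScenarioCensus

/-! ## Census KEYS (ns `…Theorems.ScenarioCensus`): the candidate cells A13isq-T / A-rec-T of row A13 — both DECIDED in the port copy of record v1.9 -/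

/-- **Cell A13isq-T** (row A13 family; Type-I ancient mild in the KNSS gauge · every slice equivariant under ONE screw of
IRRATIONAL turn `θ₀` with axial drift `h ≠ 0` ⇒ `u ≡ 0` on `t < 0`): `:= ScrewBlowdown.Row_A13isqT` (definitional alias).  DECIDED:
`row_A13isqT_excluded` below (= `ScrewBlowdown.row_A13isqT_proved`: S1 syndetic return + S2 blow-down enhancement + the `LocalPersistence`
bootstrap ⇒ `FarPastSpreading` ⇒ `LinearConeLiouville` ⇒ the cell).  The lead books the census member; row A13's value is TREE already.  (Source of the question: Koch–Nadirashvili–Seregin–Šverák 2009, §1 (L), arXiv:0709.3599; deliberately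
no citation TAG on this decided alias — a tagged parameterless `def` would be relocated to `Literature/` by the gate.) -/
def Row_A13isqT : Prop := ScrewBlowdown.Row_A13isqT

/-- **A13isq-T is EXCLUDED (decided in the tree)**: the port copy's `ScrewBlowdown.row_A13isqT_proved`. -/
theorem row_A13isqT_excluded : Row_A13isqT := ScrewBlowdown.row_A13isqT_proved

/-- **Cell A-rec-T** (row A13 family; Type-I ancient mild · AXIALLY RECURRENT modulo rotations in the Type-I gauge ⇒ `u ≡ 0`):
`:= ScrewBlowdown.Row_ArecT` (definitional alias); contains A13isq-T (`ScrewBlowdown.row_A13isqT_of_row_ArecT`).  DECIDED: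
`row_ArecT_excluded` below (= `ScrewBlowdown.row_ArecT_proved`: S3 `VanishingBlowdownLiouville` proved in v1.9 + `hasVanishingBlowdown_of_axiallyRecurrent`).
(Source of the question: Koch–Nadirashvili–Seregin–Šverák 2009, §1 (L), arXiv:0709.3599; no citation tag, see above.) -/
def Row_ArecT : Prop := ScrewBlowdown.Row_ArecT

/-- **A-rec-T is EXCLUDED (decided in the tree)**: the port copy's `ScrewBlowdown.row_ArecT_proved`. -/
theorem row_ArecT_excluded : Row_ArecT := ScrewBlowdown.row_ArecT_proved

/-- The A13isq-T key is the line's cell, definitionally. -/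
theorem row_A13isqT_iff : Row_A13isqT ↔ ScrewBlowdown.Row_A13isqT := Iff.rfl

/-- The A-rec-T key is the line's cell, definitionally. -/
theorem row_ArecT_iff : Row_ArecT ↔ ScrewBlowdown.Row_ArecT := Iff.rfl

/-- **A-rec-T ⇒ A13isq-T** at the level of the census keys (the irrational screw is axially recurrent, S1 proved). -/
theorem row_A13isqT_of_row_ArecT (h : Row_ArecT) : Row_A13isqT := ScrewBlowdown.row_A13isqT_of_row_ArecT h

end Summit.NavierStokesRegularity.NavierStokesRegularity.Theorems.ScenarioCensus
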